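import Summits.MatrixMultiplication.OmegaCensus.SmallFormats.MatMul22nRankGF7Slack5Search
import Summits.MatrixMultiplication.OmegaCensus.SmallFormats.MatMul22nRankGF7Normalise
import Summits.MatrixMultiplication.OmegaCensus.SmallFormats.MatMul22nRankGF7TightGeneral
import Literature.NumberTheory.NumberFields.NFIsoNormPoly
import HarnessLib

/-!
# ω-census family (a): semantics of the slack-5 relation data and of the need computation of the search checker

Cell `pub-omega` (unit `pub-omega-tensor-g16`), topic `Summits/MatrixMultiplication/OmegaCensus` (sub-folder `SmallFormats`).
Framing (verbatim): lottery ticket; floor = certified bounds/negative ranges. HONEST FRAMING: kernel infrastructure — first part of the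
soundness proof of `MatMul22nRankGF7Slack5Search` (`pub-omega-tensor-g16/KERNEL-S5-DESIGN.md`); nothing here is progress on `ω`.

* `relA5_eq_packW`, `relVal7_relA5`: the dense coefficient number `relA5 r` has digits `coefA5 r` and its functional is
  `Σ_{L'<L} Σ_z f_{r,L',z}·P_{torOf5 L', z} + Σ_z g_{r,z}·P_{torOf5 L, z}` (`fco5`, `gco5` = the digits of `relF5`, `relG5`);
* `rel5_congr`: at an LP-tight point of slack 5 that sum is `≡ relC5 r (mod 7)` (from the kernel-checked certificates `relOK5`);
* `relDot5_eq`: on the packed true columns `colsPack5 x L` of the levels `< L`, ONE multiplication (`relDot5`) computes the earlier-levels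
  part; `relNeed5_eq`: the level-`L` part is `≡ relNeed5` (mod 7); `det_coord5_eq`: at a determined level every coset count EQUALS its need.
-/

namespace Summit.MatrixMultiplication.OmegaCensus.SmallFormats

open Finset
open Literature.NumberTheory.NumberFields (list_sum_range_map)

-- large powers appear only symbolically
set_option exponentiation.threshold 100000

/-! ## Table facts -/

set_option maxRecDepth 100000 in
/-- `torOf5` maps the levels `≤ 8` injectively into the tori `< 21`. -/
theorem torOf5_ok : ∀ L : Fin 9, torOf5 L.val < 21 ∧ ∀ L' : Fin 9, torOf5 L.val = torOf5 L'.val → L = L' := by decide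

set_option maxRecDepth 100000 in
/-- Levels of the relations: `1 ≤ relLev5 r ≤ 8`. -/
theorem relLev5_bounds (r : ℕ) : 1 ≤ relLev5 r ∧ relLev5 r ≤ 8 := by
  unfold relLev5; split_ifs <;> omega

set_option maxRecDepth 100000 in
/-- Cross relations of the bucket levels are relations of that level. -/
theorem crossIdx5_ok : ∀ L : Fin 8, ∀ i : Fin 12, i.val < crossCnt5 L.val → crossIdx5 L.val i.val < 284 ∧ relLev5 (crossIdx5 L.val i.val) = L.val := by
  decide

set_option maxRecDepth 100000 in
/-- Relations of the determined levels 6 and 8 (`levStart5 6 = 165`, `levStart5 8 = 242`). -/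
theorem detLev5_ok : ∀ z : Fin 42, relLev5 (165 + z.val) = 6 ∧ relLev5 (242 + z.val) = 8 := by decide

set_option maxRecDepth 100000 in
set_option maxHeartbeats 4000000 in
/-- Representative values are `≤ 5`. -/
theorem repVal5_le : ∀ c : Fin 656, ∀ z : Fin 42, repVal5 c.val z.val ≤ 5 := by decide +kernel

/-! ## Coefficient digit functions and the dense coefficient number -/

/-- Coefficient of `P_{torOf5 L', z}` (`L' < relLev5 r`) in relation `r`. -/
def fco5 (r L' z : ℕ) : ℕ := fld 14 (relF5 r) (42 * (relLev5 r - 1 - L') + (41 - z))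
/-- Coefficient of `P_{torOf5 L, z}` (`L = relLev5 r`) in relation `r`. -/
def gco5 (r z : ℕ) : ℕ := fld 14 (relG5 r) (41 - z)
/-- The digit function of `relA5 r` on the 882 coordinates `u = 42·torus + z`. -/
def coefA5 (r u : ℕ) : ℕ :=
  (∑ L' ∈ range (relLev5 r), if u / 42 = torOf5 L' then fco5 r L' (u % 42) else 0) + (if u / 42 = torOf5 (relLev5 r) then gco5 r (u % 42) else 0)

/-- Coefficient bounds: `fco5 ≤ 6`, `gco5 ≤ 6` (`r < 284`, `L' < relLev5 r`, `z < 42`). -/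
theorem co5_le {r : ℕ} (hr : r < 284) : (∀ L' < relLev5 r, ∀ z < 42, fco5 r L' z ≤ 6) ∧ ∀ z < 42, gco5 r z ≤ 6 := by
  obtain ⟨hF, hG, _⟩ := relFG5_ok hr
  have hL := relLev5_bounds r
  exact ⟨fun L' hL' z hz => hF _ (by omega), fun z hz => hG _ (by omega)⟩

/-- Placing a 42-vector at torus `t < 21` in base 8: as a packing over the 882 coordinates. -/
theorem place42 (t : ℕ) (ht : t < 21) (h : ℕ → ℕ) :
    ((List.range 42).map fun z => h z * 2 ^ (3 * (42 * t + z))).sum = packW 3 (fun u => if u / 42 = t then h (u % 42) else 0) 882 := by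
  rw [list_sum_range_map]
  unfold packW
  symm
  rw [← sum_subset (show (range 42).image (fun z => 42 * t + z) ⊆ range 882 from fun u hu => by
        rw [mem_image] at hu; obtain ⟨z, hz, rfl⟩ := hu; rw [mem_range] at hz ⊢; omega)
      (fun u _ hnot => by
        have hne : ¬ u / 42 = t := fun hut => hnot (mem_image.2 ⟨u % 42, mem_range.2 (Nat.mod_lt _ (by norm_num)), by omega⟩)
        simp only [if_neg hne, zero_mul])]
  rw [sum_image (fun z _ z' _ h => by omega)]
  refine sum_congr rfl fun z hz => ?_
  have hz' := mem_range.1 hz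
  simp only [show (42 * t + z) / 42 = t by omega, show (42 * t + z) % 42 = z by omega, if_true]

/-- Summing a function against a placed 42-vector collapses to the torus: `Σ_u [u/42 = t]·h(u%42)·Q u = Σ_z h z · Q (42t+z)`. -/
theorem sum_place42 (t : ℕ) (ht : t < 21) (h : ℕ → ℕ) (Q : ℕ → ℤ) :
    ∑ u ∈ range 882, (if u / 42 = t then (h (u % 42) : ℤ) else 0) * Q u = ∑ z ∈ range 42, (h z : ℤ) * Q (42 * t + z) := by
  symm
  rw [← sum_subset (show (range 42).image (fun z => 42 * t + z) ⊆ range 882 from fun u hu => by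
        rw [mem_image] at hu; obtain ⟨z, hz, rfl⟩ := hu; rw [mem_range] at hz ⊢; omega)
      (fun u _ hnot => by
        have hne : ¬ u / 42 = t := fun hut => hnot (mem_image.2 ⟨u % 42, mem_range.2 (Nat.mod_lt _ (by norm_num)), by omega⟩)
        simp only [if_neg hne, zero_mul])]
  rw [sum_image (fun z _ z' _ h => by omega)]
  refine sum_congr rfl fun z hz => ?_
  have hz' := mem_range.1 hz
  simp only [show (42 * t + z) / 42 = t by omega, show (42 * t + z) % 42 = z by omega, if_true]

/-- **`relA5 r` is the base-8 packing of `coefA5 r`.** -/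
theorem relA5_eq_packW (r : ℕ) : relA5 r = packW 3 (coefA5 r) 882 := by
  have hL := relLev5_bounds r
  have ht : ∀ L' ≤ relLev5 r, torOf5 L' < 21 := fun L' hL' => (torOf5_ok ⟨L', by omega⟩).1
  unfold relA5
  rw [list_sum_range_map]
  have e1 : ∀ L' ∈ range (relLev5 r), ((List.range 42).map fun z =>
      fld 14 (relF5 r) (42 * (relLev5 r - 1 - L') + (41 - z)) * 2 ^ (3 * (42 * torOf5 L' + z))).sum
      = packW 3 (fun u => if u / 42 = torOf5 L' then fco5 r L' (u % 42) else 0) 882 := by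
    intro L' hL'
    exact place42 _ (ht L' (by have := mem_range.1 hL'; omega)) (fco5 r L')
  have e2 : ((List.range 42).map fun z => fld 14 (relG5 r) (41 - z) * 2 ^ (3 * (42 * torOf5 (relLev5 r) + z))).sum
      = packW 3 (fun u => if u / 42 = torOf5 (relLev5 r) then gco5 r (u % 42) else 0) 882 := place42 _ (ht _ le_rfl) (gco5 r)
  rw [sum_congr rfl e1, e2, ← packW_sum, ← packW_add]
  rfl

/-- The digit function is `≤ 6` (at most one placed vector meets each coordinate). -/
theorem coefA5_le {r : ℕ} (hr : r < 284) (u : ℕ) : coefA5 r u ≤ 6 := by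
  have hL := relLev5_bounds r
  obtain ⟨hf, hg⟩ := co5_le hr
  have hinj : ∀ a b : ℕ, a ≤ relLev5 r → b ≤ relLev5 r → torOf5 a = torOf5 b → a = b := by
    intro a b ha hb hab
    have := (torOf5_ok ⟨a, by omega⟩).2 ⟨b, by omega⟩ hab
    simpa using this
  unfold coefA5
  have hz : u % 42 < 42 := Nat.mod_lt _ (by norm_num)
  by_cases hG : u / 42 = torOf5 (relLev5 r)
  · rw [if_pos hG, sum_eq_zero]
    · have := hg _ hz; omega
    · intro L' hL'
      have hL'' := mem_range.1 hL'
      rw [if_neg]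
      intro he
      have := hinj L' (relLev5 r) (by omega) le_rfl (he.symm.trans hG)
      omega
  · rw [if_neg hG, add_zero]
    by_cases hex : ∃ L' < relLev5 r, u / 42 = torOf5 L'
    · obtain ⟨L0, hL0, hu0⟩ := hex
      rw [sum_eq_single L0]
      · rw [if_pos hu0]; exact hf L0 hL0 _ hz
      · intro L' hL' hne
        rw [if_neg]
        intro he
        exact hne (hinj L' L0 (by have := mem_range.1 hL'; omega) (by omega) (he.symm.trans hu0))
      · intro hn; exact absurd (mem_range.2 hL0) hn
    · rw [sum_eq_zero]
      · omega
      · intro L' hL'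
        rw [if_neg]
        intro he
        exact hex ⟨L', mem_range.1 hL', he⟩

set_option maxHeartbeats 1600000 in
/-- **The functional of relation `r`** at a point `x`, in terms of the coefficient digits and the coset counts `colN7`. -/
theorem relVal7_relA5 {r : ℕ} (hr : r < 284) (x : ℕ → ℕ) :
    relVal7 (relA5 r) x = ∑ L' ∈ range (relLev5 r), ∑ z ∈ range 42, (fco5 r L' z : ℤ) * (colN7 x (torOf5 L') z : ℤ)
      + ∑ z ∈ range 42, (gco5 r z : ℤ) * (colN7 x (torOf5 (relLev5 r)) z : ℤ) := by
  have hL := relLev5_bounds r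
  have ht : ∀ L' ≤ relLev5 r, torOf5 L' < 21 := fun L' hL' => (torOf5_ok ⟨L', by omega⟩).1
  unfold relVal7
  have hd : ∀ u ∈ range 882, (fld 3 (relA5 r) u : ℤ) * xrs7 x (cosetRow7 (u / 42) (u % 42))
      = ∑ L' ∈ range (relLev5 r), (if u / 42 = torOf5 L' then (fco5 r L' (u % 42) : ℤ) else 0) * (colN7 x (u / 42) (u % 42) : ℤ)
        + (if u / 42 = torOf5 (relLev5 r) then (gco5 r (u % 42) : ℤ) else 0) * (colN7 x (u / 42) (u % 42) : ℤ) := by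
    intro u hu
    rw [relA5_eq_packW r, fld_packW _ (fun i _ => by have := coefA5_le hr i; omega), if_pos (mem_range.1 hu), colN7_cast]
    simp only [coefA5, Nat.cast_add, Nat.cast_sum, Nat.cast_ite, Nat.cast_zero, add_mul, sum_mul]
  rw [sum_congr rfl hd, sum_add_distrib, sum_comm]
  have h1 : ∑ L' ∈ range (relLev5 r), ∑ u ∈ range 882,
      (if u / 42 = torOf5 L' then (fco5 r L' (u % 42) : ℤ) else 0) * (colN7 x (u / 42) (u % 42) : ℤ)
      = ∑ L' ∈ range (relLev5 r), ∑ z ∈ range 42, (fco5 r L' z : ℤ) * (colN7 x (torOf5 L') z : ℤ) := by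
    refine sum_congr rfl fun L' hL' => ?_
    rw [sum_place42 _ (ht L' (by have := mem_range.1 hL'; omega)) (fco5 r L') (fun u => (colN7 x (u / 42) (u % 42) : ℤ))]
    refine sum_congr rfl fun z hz => ?_
    have hz' := mem_range.1 hz
    show (fco5 r L' z : ℤ) * (colN7 x ((42 * torOf5 L' + z) / 42) ((42 * torOf5 L' + z) % 42) : ℤ) = _
    rw [show (42 * torOf5 L' + z) / 42 = torOf5 L' by omega, show (42 * torOf5 L' + z) % 42 = z by omega]
  have h2 : ∑ u ∈ range 882, (if u / 42 = torOf5 (relLev5 r) then (gco5 r (u % 42) : ℤ) else 0) * (colN7 x (u / 42) (u % 42) : ℤ)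
      = ∑ z ∈ range 42, (gco5 r z : ℤ) * (colN7 x (torOf5 (relLev5 r)) z : ℤ) := by
    rw [sum_place42 _ (ht _ le_rfl) (gco5 r) (fun u => (colN7 x (u / 42) (u % 42) : ℤ))]
    refine sum_congr rfl fun z hz => ?_
    have hz' := mem_range.1 hz
    show (gco5 r z : ℤ) * (colN7 x ((42 * torOf5 (relLev5 r) + z) / 42) ((42 * torOf5 (relLev5 r) + z) % 42) : ℤ) = _
    rw [show (42 * torOf5 (relLev5 r) + z) / 42 = torOf5 (relLev5 r) by omega,
      show (42 * torOf5 (relLev5 r) + z) % 42 = z by omega]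
  rw [h1, h2]

/-- **The congruence of relation `r` at an LP-tight point of slack 5** (in `ℕ`): the sum of the earlier-levels part and the level part
is `≡ relC5 r (mod 7)`, and `relC5 r < 7`. -/
theorem rel5_congr {r : ℕ} (hr : r < 284) (x : ℕ → ℕ) (hT : ∀ t < 384, xrs7 x t = 5) (hR : ∀ k < 8, xrs7 x (1266 + k) = 2 * (5 : ℤ)) :
    (∑ L' ∈ range (relLev5 r), ∑ z ∈ range 42, fco5 r L' z * colN7 x (torOf5 L') z
      + ∑ z ∈ range 42, gco5 r z * colN7 x (torOf5 (relLev5 r)) z) % 7 = relC5 r ∧ relC5 r < 7 := by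
  obtain ⟨hok, hc⟩ := relOK5 hr
  have hc7 : relC5 r < 7 := by rw [hc]; exact Nat.mod_lt _ (by norm_num)
  refine ⟨?_, hc7⟩
  have h := rel7_of_relOK7 hok 5 x (fun t ht => by exact_mod_cast hT t ht) hR
  rw [relVal7_relA5 hr x, ← relConstL7_eq] at h
  -- h : (S : ℤ) % 7 = (5 * κ : ℤ) % 7 ; compare in ℕ
  have h2 : (((∑ L' ∈ range (relLev5 r), ∑ z ∈ range 42, fco5 r L' z * colN7 x (torOf5 L') z
      + ∑ z ∈ range 42, gco5 r z * colN7 x (torOf5 (relLev5 r)) z : ℕ) : ℤ)) % 7 = (((5 * relConstL7 (relW5 r)) % 7 : ℕ) : ℤ) := by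
    push_cast at h ⊢
    rw [h]
  rw [← hc] at h2
  have h3 : (((∑ L' ∈ range (relLev5 r), ∑ z ∈ range 42, fco5 r L' z * colN7 x (torOf5 L') z
      + ∑ z ∈ range 42, gco5 r z * colN7 x (torOf5 (relLev5 r)) z) % 7 : ℕ) : ℤ) = ((relC5 r : ℕ) : ℤ) := by
    rw [Int.natCast_mod]; exact h2
  exact_mod_cast h3

/-! ## The packed true columns and the need computation -/

/-- Packed coset counts of torus `j` at the point `x` (base `2^14`). -/
def colPack5 (x : ℕ → ℕ) (j : ℕ) : ℕ := packW 14 (colN7 x j) 42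
/-- Packed columns of the levels `< L`. -/
def colsPack5 (x : ℕ → ℕ) (L : ℕ) : ℕ := packW 588 (fun L' => colPack5 x (torOf5 L')) L

/-- Step of the packed columns. -/
theorem colsPack5_succ (x : ℕ → ℕ) (L : ℕ) : colsPack5 x (L + 1) = colsPack5 x L + colPack5 x (torOf5 L) * 2 ^ (588 * L) := by
  unfold colsPack5 packW; rw [sum_range_succ]

/-- The packed columns as one long digit vector. -/
theorem colsPack5_flat (x : ℕ → ℕ) (L : ℕ) :
    colsPack5 x L = packW 14 (fun i => colN7 x (torOf5 (i / 42)) (i % 42)) (42 * L) := by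
  unfold colsPack5 colPack5
  rw [show (588 : ℕ) = 14 * 42 by norm_num]
  exact packW_nest 14 42 (fun L' z => colN7 x (torOf5 L') z) L

/-- Splitting a sum over `42·L` indices into levels and coordinates. -/
theorem sum_range_mul42 (h : ℕ → ℕ) (L : ℕ) : ∑ i ∈ range (42 * L), h i = ∑ L' ∈ range L, ∑ z ∈ range 42, h (42 * L' + z) := by
  induction L with
  | zero => simp
  | succ L ih =>
    rw [show 42 * (L + 1) = 42 * L + 42 by ring, sum_range_add, ih,
      sum_range_succ (fun L' => ∑ z ∈ range 42, h (42 * L' + z)) L]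

/-- **The multiplication in `relDot5` computes the earlier-levels part** of relation `r` (level `L = relLev5 r`) on the packed true
columns of an `x` whose coset counts are `≤ 5`. -/
theorem relDot5_eq {r : ℕ} (hr : r < 284) (x : ℕ → ℕ) (hx : ∀ j < 21, ∀ z < 42, colN7 x j z ≤ 5) :
    relDot5 r (relLev5 r) (colsPack5 x (relLev5 r)) = ∑ L' ∈ range (relLev5 r), ∑ z ∈ range 42, fco5 r L' z * colN7 x (torOf5 L') z := by
  have hL := relLev5_bounds r
  obtain ⟨hF, _, _, _, hFlt, _⟩ := relFG5_ok hr
  set N := 42 * relLev5 r with hN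
  have hNpos : 0 < N := by omega
  -- relF5 r as the reversed packing of l i := fld 14 (relF5 r) (N - 1 - i)
  have hself : packW 14 (fun j => fld 14 (relF5 r) j) N = relF5 r :=
    packW_fld_self (W := 14) (by norm_num) (by rw [hN]; exact hFlt)
  have hF' : relF5 r = packW 14 (fun i => fld 14 (relF5 r) (N - 1 - (N - 1 - i))) N :=
    hself.symm.trans (packW_congr 14 fun i hi => by rw [show N - 1 - (N - 1 - i) = i by omega])
  unfold relDot5
  rw [colsPack5_flat, show 42 * (relLev5 r - 1) + 41 = N - 1 by omega, ← hN, hF']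
  have hb : N * (5 * 6) < 2 ^ 14 := lt_of_le_of_lt (Nat.mul_le_mul_right _ (show N ≤ 336 by omega)) (by norm_num)
  have hp : ∀ i < N, (fun i => colN7 x (torOf5 (i / 42)) (i % 42)) i ≤ 5 := fun i hi => by
    show colN7 x (torOf5 (i / 42)) (i % 42) ≤ 5
    exact hx _ (torOf5_ok ⟨i / 42, by omega⟩).1 _ (Nat.mod_lt _ (by norm_num))
  have hl : ∀ i < N, (fun i => fld 14 (relF5 r) (N - 1 - i)) i ≤ 6 := fun i hi => by
    show fld 14 (relF5 r) (N - 1 - i) ≤ 6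
    exact hF _ (by omega)
  rw [dot_digitW (A := 5) (B := 6) _ (fun i => fld 14 (relF5 r) (N - 1 - i)) hNpos hb hp hl]
  rw [hN, sum_range_mul42]
  refine sum_congr rfl fun L' hL' => sum_congr rfl fun z hz => ?_
  have hL'' := mem_range.1 hL'; have hz' := mem_range.1 hz
  rw [show (42 * L' + z) / 42 = L' by omega, show (42 * L' + z) % 42 = z by omega, mul_comm]
  unfold fco5
  congr 2
  omega

/-- **The need is the residue of the level part** at an LP-tight point of slack 5 whose packed earlier columns are given. -/
theorem relNeed5_eq {r : ℕ} (hr : r < 284) (x : ℕ → ℕ) (hx : ∀ j < 21, ∀ z < 42, colN7 x j z ≤ 5)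
    (hT : ∀ t < 384, xrs7 x t = 5) (hR : ∀ k < 8, xrs7 x (1266 + k) = 2 * (5 : ℤ)) :
    (∑ z ∈ range 42, gco5 r z * colN7 x (torOf5 (relLev5 r)) z) % 7 = relNeed5 r (relLev5 r) (colsPack5 x (relLev5 r))
      ∧ relNeed5 r (relLev5 r) (colsPack5 x (relLev5 r)) < 7 := by
  obtain ⟨hcong, hc7⟩ := rel5_congr hr x hT hR
  unfold relNeed5
  rw [relDot5_eq hr x hx]
  constructor <;> omega

/-- `relNeed5_eq` with the level as an explicit parameter. -/
theorem relNeed5_eqL {r L : ℕ} (hr : r < 284) (hL : relLev5 r = L) (x : ℕ → ℕ) (hx : ∀ j < 21, ∀ z < 42, colN7 x j z ≤ 5)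
    (hT : ∀ t < 384, xrs7 x t = 5) (hR : ∀ k < 8, xrs7 x (1266 + k) = 2 * (5 : ℤ)) :
    (∑ z ∈ range 42, gco5 r z * colN7 x (torOf5 L) z) % 7 = relNeed5 r L (colsPack5 x L) ∧ relNeed5 r L (colsPack5 x L) < 7 := by
  subst hL; exact relNeed5_eq hr x hx hT hR

/-- Digits of a single power: `fld 14 (2^(14 a)) b = [b = a]`. -/
theorem fld14_two_pow (a b : ℕ) : fld 14 (2 ^ (14 * a)) b = if b = a then 1 else 0 := by
  have e : packW 14 (fun i => if i = a then 1 else 0) (a + 1) = 2 ^ (14 * a) := by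
    rw [packW_single 14 (show a < a + 1 by omega), one_mul]
  rw [← e, fld_packW _ (fun i _ => by show (if i = a then 1 else 0) < 2 ^ 14; split_ifs <;> norm_num)]
  by_cases h : b = a
  · subst h; simp
  · rw [if_neg h]; split_ifs <;> rfl

/-- **At a determined level every coset count equals its need.** For `L = 6` or `8` and `z < 42`, relation `levStart5 L + z` has level
part `P_{torOf5 L, z}` exactly, so `colN7 x (torOf5 L) z = relNeed5 (levStart5 L + z) L (colsPack5 x L)`. -/
theorem det_coord5_eq {L : ℕ} (hL : L = 6 ∨ L = 8) (x : ℕ → ℕ) (hx : ∀ j < 21, ∀ z < 42, colN7 x j z ≤ 5)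
    (hT : ∀ t < 384, xrs7 x t = 5) (hR : ∀ k < 8, xrs7 x (1266 + k) = 2 * (5 : ℤ)) {z : ℕ} (hz : z < 42) :
    colN7 x (torOf5 L) z = relNeed5 (levStart5 L + z) L (colsPack5 x L) := by
  have hdet := relG5_det ⟨z, hz⟩
  have hlev := detLev5_ok ⟨z, hz⟩
  have hr : levStart5 L + z < 284 := by rcases hL with rfl | rfl <;> simp [levStart5] <;> omega
  have hrl : relLev5 (levStart5 L + z) = L := by
    rcases hL with rfl | rfl
    · exact hlev.1
    · exact hlev.2
  have hG : relG5 (levStart5 L + z) = 2 ^ (14 * (41 - z)) := by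
    rcases hL with rfl | rfl
    · exact hdet.1
    · exact hdet.2
  have hneed := relNeed5_eq hr x hx hT hR
  rw [hrl] at hneed
  -- the level part is the single coordinate z
  have hsum : ∑ z' ∈ range 42, gco5 (levStart5 L + z) z' * colN7 x (torOf5 L) z' = colN7 x (torOf5 L) z := by
    unfold gco5
    rw [hG]
    rw [sum_eq_single z]
    · rw [fld14_two_pow, if_pos rfl, one_mul]
    · intro z' hz' hne
      rw [fld14_two_pow, if_neg (by have := mem_range.1 hz'; omega), zero_mul]
    · intro h; exact absurd (mem_range.2 hz) h
  rw [hsum] at hneed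
  have hle : colN7 x (torOf5 L) z ≤ 5 := hx _ (torOf5_ok ⟨L, by rcases hL with rfl | rfl <;> norm_num⟩).1 _ hz
  omega

end Summit.MatrixMultiplication.OmegaCensus.SmallFormats
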